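import Summits.Ventures.PercRepro.RankLevelSetRuleQElevenCertDefsLo2

/-!
# PercRepro — THE PARTIAL PRODUCTS OF THE LOWER CERTIFICATE OF THE FAMILY `k = 11` (p4, gen 25; C-044; paper §13.7): the two identities
`N^h·na + D^h·nb = P^h` (`h = G, H`; the lower convergent, eighths of the short factor), each one `ring` with the short half-factor on the left.
No `sorry`; axioms standard.
-/

namespace PercRepro

set_option maxHeartbeats 6400000 in
set_option maxRecDepth 16384 in
/-- The partial product identity G of the lower certificate: `N_19^G·na + D_19^G·nb` in `(q, m)` — the short part
(19 + 21 monomials) on the left of each product. -/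
lemma eleven_lower_prodG (q m : ℚ) :
    cfNineteenN8G q m * naEleven q m + cfNineteenD8G q m * nbEleven q m = pLowerElevenG q m := by
  unfold cfNineteenN8G cfNineteenD8G naEleven nbEleven pLowerElevenG; ring

set_option maxHeartbeats 6400000 in
set_option maxRecDepth 16384 in
/-- The partial product identity H of the lower certificate: `N_19^H·na + D_19^H·nb` in `(q, m)` — the short part
(20 + 21 monomials) on the left of each product. -/
lemma eleven_lower_prodH (q m : ℚ) :
    cfNineteenN8H q m * naEleven q m + cfNineteenD8H q m * nbEleven q m = pLowerElevenH q m := by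
  unfold cfNineteenN8H cfNineteenD8H naEleven nbEleven pLowerElevenH; ring

end PercRepro
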